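import Mathlib
import Summits.CriticalPhenomena.Ising3DConformalLimit.Theorems.PrecisionLaplacianEtaBoundsTransferTrig
import Summits.CriticalPhenomena.Ising3DConformalLimit.Theorems.PrecisionLaplacianEtaBoundsTransferOrtho
import Literature.Probability.LatticeModels.SharpnessProofs
import HarnessLib

/-!
# Stub `stub_spectralBallMass` of line `diffusive-branch-is-nonsaturation` (crux
# `PrecisionLaplacian.DirectCorrelationStableTail`, stmt-CriticalPhenomena-4799): the infrared
# envelope caps the spectral mass of small cubes

**Statement** (registered text, = `stub_spectralBallMass` of the lead's skeleton).  Let `G ≥ 0` be a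
kernel on `ℤ³` with the "susceptibility" bound `Σ_{x,x'∈Λ_R} G(x'−x) ≤ C_G (2R+1)⁵` for all `R`
(`Λ_R = box 3 R = {−R,…,R}³`), let `g̃_L(k) = Σ_{z,z'∈Λ_L} G(z'−z) cos(k·(z'−z)) ≥ 0` be the
approximate spectral density, and assume the count bound `#{(z,z') ∈ Λ_L² : z'−z = w} ≤ (2L+1)³`
and the Parseval identity `∫_K W_R g̃_L = (2π)³ Σ_{x,x'∈Λ_R} G(x'−x) #{(z,z') ∈ Λ_L² : z'−z = x'−x}`
for the box block weight `W_R(k) = Σ_{x,x'∈Λ_R} cos(k·(x'−x))` on the cube `K = [-π,π]³`.  Then for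
`0 < ρ ≤ 1` the `g̃_L`-mass of the small cube `K_ρ = [-ρ,ρ]³` is at most `64 (2π)³ C_G ρ (2L+1)³`.

**Proof.**  Put `N = ⌊1/ρ⌋`, so `N ρ ≤ 1` and `1 ≤ ρ (2N+1)`.  On `K_ρ` every `|m k_j| ≤ N ρ ≤ 1`
for `|m| ≤ N`, hence `cos(m k_j) ≥ 1 − (m k_j)²/2 ≥ 1/2` and the Dirichlet kernel satisfies
`D_N(k_j) = Σ_{|m| ≤ N} cos(m k_j) ≥ (2N+1)/2`; by `W_N = (∏_j D_N(k_j))²`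
(`EtaBoundsTransfer.sum_box_box_cos_phase_sub`) the block weight is `≥ (2N+1)⁶/64` on `K_ρ`.
Since `g̃_L ≥ 0` and `W_N ≥ 0`,
`∫_{K_ρ} g̃_L ≤ (64/(2N+1)⁶) ∫_{K_ρ} W_N g̃_L ≤ (64/(2N+1)⁶) ∫_K W_N g̃_L`, and by Parseval, the count
bound and the susceptibility bound the last integral is `≤ (2π)³ (2L+1)³ C_G (2N+1)⁵`; finally
`1/(2N+1) ≤ ρ`.

Pure theorem file, no definitions, no `sorry`.  [folklore]
-/

noncomputable section

namespace Summit.CriticalPhenomena.Ising3DConformalLimit.Cruxes.DirectCorrelationStableTail.DiffusiveBranchIsNonsaturation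

open MeasureTheory Filter Topology
open scoped BigOperators
open Literature.Probability.LatticeModels
open Literature.Barriers.CriticalPhenomena.SpreadOutIsing (dirichletRowSum)
open Summit.CriticalPhenomena.Ising3DConformalLimit.Theorems

/-! ### The Dirichlet kernel and the block weight near the origin -/

/-- Near the origin the Dirichlet kernel is large: if `N |t| ≤ 1` then
`D_N(t) = Σ_{m=-N}^{N} cos(m t) ≥ (2N+1)/2` (each `cos(m t) ≥ 1 − (m t)²/2 ≥ 1/2`). [folklore] -/
theorem spectralBallMass_dirichletRowSum_lower (N : ℕ) {t : ℝ} (ht : (N : ℝ) * |t| ≤ 1) :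
    (2 * N + 1 : ℝ) / 2 ≤ dirichletRowSum N t := by
  have hcard : (Finset.Icc (-(N : ℤ)) N).card = 2 * N + 1 := by
    rw [Int.card_Icc]; omega
  have hsum : ∑ _m ∈ Finset.Icc (-(N : ℤ)) N, (1 / 2 : ℝ) = (2 * N + 1 : ℝ) / 2 := by
    rw [Finset.sum_const, hcard, nsmul_eq_mul]
    push_cast
    ring
  rw [dirichletRowSum, ← hsum]
  refine Finset.sum_le_sum fun m hm => ?_
  rw [Finset.mem_Icc] at hm
  have hm' : |(m : ℝ)| ≤ N := by
    rw [abs_le]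
    exact ⟨by exact_mod_cast hm.1, by exact_mod_cast hm.2⟩
  have h1 : |(m : ℝ) * t| ≤ 1 := by
    rw [abs_mul]
    calc |(m : ℝ)| * |t| ≤ N * |t| := mul_le_mul_of_nonneg_right hm' (abs_nonneg t)
      _ ≤ 1 := ht
  have h2 : ((m : ℝ) * t) ^ 2 ≤ 1 := (sq_le_one_iff_abs_le_one _).2 h1
  have h3 : 1 - ((m : ℝ) * t) ^ 2 / 2 ≤ Real.cos ((m : ℝ) * t) := Real.one_sub_sq_div_two_le_cos
  linarith

/-- The box block weight `Σ_{x,x'∈Λ_N} cos(k·(x'−x))` is the perfect square `(∏_j D_N(k_j))²`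
(the tree lemma `sum_box_box_cos_phase_sub`, with `x' − x` in place of `x − x'`). [folklore] -/
theorem spectralBallMass_weight_eq (N : ℕ) (k : Fin 3 → ℝ) :
    ∑ x ∈ box 3 N, ∑ x' ∈ box 3 N, Real.cos (phase 3 k (x' - x))
      = (∏ j : Fin 3, dirichletRowSum N (k j)) ^ 2 := by
  rw [← EtaBoundsTransfer.sum_box_box_cos_phase_sub]
  refine Finset.sum_congr rfl fun x _ => Finset.sum_congr rfl fun x' _ => ?_
  rw [← neg_sub, phase_neg, Real.cos_neg]

/-- The box block weight is nonnegative. [folklore] -/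
theorem spectralBallMass_weight_nonneg (N : ℕ) (k : Fin 3 → ℝ) :
    0 ≤ ∑ x ∈ box 3 N, ∑ x' ∈ box 3 N, Real.cos (phase 3 k (x' - x)) := by
  rw [spectralBallMass_weight_eq]
  positivity

/-- **Lower bound for the block weight near the origin**: if `N |k_j| ≤ 1` for all `j`, then
`Σ_{x,x'∈Λ_N} cos(k·(x'−x)) ≥ (2N+1)⁶/64`. [folklore] -/
theorem spectralBallMass_weight_lower (N : ℕ) {k : Fin 3 → ℝ} (hk : ∀ j, (N : ℝ) * |k j| ≤ 1) :
    (2 * N + 1 : ℝ) ^ 6 / 64 ≤ ∑ x ∈ box 3 N, ∑ x' ∈ box 3 N, Real.cos (phase 3 k (x' - x)) := by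
  rw [spectralBallMass_weight_eq]
  have h3 : (0 : ℝ) ≤ ((2 * N + 1 : ℝ) / 2) ^ 3 := by positivity
  have h2 : ((2 * N + 1 : ℝ) / 2) ^ 3 ≤ ∏ j : Fin 3, dirichletRowSum N (k j) := by
    rw [← Fin.prod_const]
    exact Finset.prod_le_prod (fun j _ => by positivity)
      fun j _ => spectralBallMass_dirichletRowSum_lower N (hk j)
  calc (2 * N + 1 : ℝ) ^ 6 / 64 = (((2 * N + 1 : ℝ) / 2) ^ 3) ^ 2 := by ring
    _ ≤ (∏ j : Fin 3, dirichletRowSum N (k j)) ^ 2 := pow_le_pow_left₀ h3 h2 2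

/-! ### The abstract mass bound -/

/-- **Abstract small-cube mass bound.**  If `g, W ≥ 0` are continuous on `ℝ³`, `W ≥ A > 0` on the
small cube `K_ρ = [-ρ,ρ]³` (`ρ ≤ 1`) and `∫_K W g ≤ B` on the cube `K = [-π,π]³ ⊇ K_ρ`, then
`∫_{K_ρ} g ≤ B / A`. [folklore] -/
theorem spectralBallMass_of_weight {g W : (Fin 3 → ℝ) → ℝ} {ρ A B : ℝ} (hρ1 : ρ ≤ 1)
    (hg : Continuous g) (hW : Continuous W) (hg0 : ∀ k, 0 ≤ g k) (hW0 : ∀ k, 0 ≤ W k)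
    (hA : 0 < A) (hWlow : ∀ k ∈ Set.pi Set.univ (fun _ : Fin 3 => Set.Icc (-ρ) ρ), A ≤ W k)
    (hB : ∫ k in Set.pi Set.univ (fun _ : Fin 3 => Set.Icc (-Real.pi) Real.pi), W k * g k ≤ B) :
    ∫ k in Set.pi Set.univ (fun _ : Fin 3 => Set.Icc (-ρ) ρ), g k ≤ B / A := by
  set Kρ : Set (Fin 3 → ℝ) := Set.pi Set.univ (fun _ : Fin 3 => Set.Icc (-ρ) ρ) with hKρ
  set K : Set (Fin 3 → ℝ) := Set.pi Set.univ (fun _ : Fin 3 => Set.Icc (-Real.pi) Real.pi) with hK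
  have hKc : IsCompact Kρ := isCompact_univ_pi fun _ => isCompact_Icc
  have hKm : MeasurableSet Kρ := MeasurableSet.univ_pi fun _ => measurableSet_Icc
  have hπ := Real.pi_gt_three
  have hsub : Kρ ⊆ K :=
    Set.pi_mono fun _ _ => Set.Icc_subset_Icc (by linarith) (by linarith)
  have hWg : Continuous fun k => W k * g k := hW.mul hg
  have hA' : (0 : ℝ) ≤ A⁻¹ := inv_nonneg.mpr hA.le
  have h1 : ∫ k in Kρ, g k ≤ ∫ k in Kρ, A⁻¹ * (W k * g k) := by
    refine setIntegral_mono_on (hg.continuousOn.integrableOn_compact hKc)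
      ((continuous_const.mul hWg).continuousOn.integrableOn_compact hKc) hKm fun k hk => ?_
    have h := hWlow k hk
    have hgk : g k = A⁻¹ * (A * g k) := by
      rw [← mul_assoc, inv_mul_cancel₀ hA.ne', one_mul]
    calc g k = A⁻¹ * (A * g k) := hgk
      _ ≤ A⁻¹ * (W k * g k) :=
        mul_le_mul_of_nonneg_left (mul_le_mul_of_nonneg_right h (hg0 k)) hA'
  have h2 : ∫ k in Kρ, A⁻¹ * (W k * g k) = A⁻¹ * ∫ k in Kρ, W k * g k :=
    integral_const_mul _ _
  have h3 : ∫ k in Kρ, W k * g k ≤ ∫ k in K, W k * g k :=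
    setIntegral_mono_set (EtaBoundsTransfer.integrableOn_cube_of_continuous hWg)
      (Eventually.of_forall fun k => mul_nonneg (hW0 k) (hg0 k)) (Eventually.of_forall hsub)
  calc ∫ k in Kρ, g k ≤ A⁻¹ * ∫ k in Kρ, W k * g k := h1.trans_eq h2
    _ ≤ A⁻¹ * B := mul_le_mul_of_nonneg_left (h3.trans hB) hA'
    _ = B / A := by rw [inv_mul_eq_div]

/-! ### The registered stub -/

/-- **Stub C `stub_spectralBallMass` (the envelope caps the spectral mass of small cubes; Ising-free).**  If `G ≥ 0`,
`Σ_{x,x'∈Λ_R} G(x'−x) ≤ C_G (2R+1)⁵` for all `R` (the envelope `G ≤ C₀/‖x‖`), `g̃_L ≥ 0`, and the Parseval identity of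
stub A for `u = 𝟙_{Λ_R}` together with the count bound of stub B hold, then
`∫_{K_ρ} g̃_L ≤ 64 (2π)³ C_G ρ (2L+1)³` for `0 < ρ ≤ 1`: with `R'' = ⌊1/ρ⌋`, on `K_ρ` every `cos(m k_j) ≥ cos 1 ≥ 1/2`
(`|m| ≤ R''`), so the block weight `Σ_{x,x'∈Λ_{R''}} cos k·(x'−x) = (∏_j D_{R''}(k_j))² ≥ (2R''+1)⁶/64`
(`EtaBoundsTransfer.sum_box_box_cos_phase_sub`, `dirichletRowSum`), and `1/(2R''+1) ≤ ρ`. [folklore] -/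
theorem stub_spectralBallMass :
    ∀ (G : Site 3 → ℝ) (C_G : ℝ) (L : ℕ), (∀ w, 0 ≤ G w) → 0 ≤ C_G →
      (∀ R : ℕ, ∑ x ∈ box 3 R, ∑ x' ∈ box 3 R, G (x' - x) ≤ C_G * (2 * R + 1) ^ 5) →
      (∀ k : Fin 3 → ℝ, 0 ≤ (∑ z ∈ box 3 L, ∑ z' ∈ box 3 L, G (z' - z) * Real.cos (phase 3 k (z' - z)))) →
      (∀ w : Site 3, (((box 3 L) ×ˢ (box 3 L)).filter (fun p : Site 3 × Site 3 => p.2 - p.1 = w)).card ≤ (2 * L + 1) ^ 3) →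
      (∀ R : ℕ, ∫ k in Set.pi Set.univ (fun _ : Fin 3 => Set.Icc (-Real.pi) Real.pi),
          (∑ x ∈ box 3 R, ∑ x' ∈ box 3 R, Real.cos (phase 3 k (x' - x))) * (∑ z ∈ box 3 L, ∑ z' ∈ box 3 L, G (z' - z) * Real.cos (phase 3 k (z' - z)))
        = (2 * Real.pi) ^ 3 * ∑ x ∈ box 3 R, ∑ x' ∈ box 3 R, G (x' - x) * ((((box 3 L) ×ˢ (box 3 L)).filter (fun p : Site 3 × Site 3 => p.2 - p.1 = x' - x)).card : ℝ)) →
      ∀ ρ : ℝ, 0 < ρ → ρ ≤ 1 →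
        ∫ k in Set.pi Set.univ (fun _ : Fin 3 => Set.Icc (-ρ) ρ), (∑ z ∈ box 3 L, ∑ z' ∈ box 3 L, G (z' - z) * Real.cos (phase 3 k (z' - z)))
          ≤ 64 * (2 * Real.pi) ^ 3 * C_G * ρ * (2 * L + 1) ^ 3 := by
  intro G C_G L hG hC hSus hpos hcount hPars ρ hρ hρ1
  -- the scale `N = ⌊1/ρ⌋`: `N ρ ≤ 1` and `1 ≤ ρ (2N+1)`
  obtain ⟨N, hNρ, hρN⟩ : ∃ N : ℕ, (N : ℝ) * ρ ≤ 1 ∧ 1 ≤ ρ * (2 * N + 1) := by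
    refine ⟨⌊1 / ρ⌋₊, (le_div_iff₀ hρ).mp (Nat.floor_le (by positivity)), ?_⟩
    have h := (div_lt_iff₀ hρ).mp (Nat.lt_floor_add_one (1 / ρ))
    have h' : (0 : ℝ) ≤ (⌊1 / ρ⌋₊ : ℝ) * ρ := by positivity
    nlinarith
  have hM : (0 : ℝ) < 2 * N + 1 := by positivity
  -- continuity of the approximate spectral density and of the block weight
  have hg_cont : Continuous fun k : Fin 3 → ℝ =>
      ∑ z ∈ box 3 L, ∑ z' ∈ box 3 L, G (z' - z) * Real.cos (phase 3 k (z' - z)) :=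
    continuous_finsetSum _ fun z _ => continuous_finsetSum _ fun z' _ =>
      continuous_const.mul (Real.continuous_cos.comp (EtaBoundsTransfer.continuous_phase _))
  have hW_cont : Continuous fun k : Fin 3 → ℝ =>
      ∑ x ∈ box 3 N, ∑ x' ∈ box 3 N, Real.cos (phase 3 k (x' - x)) :=
    continuous_finsetSum _ fun x _ => continuous_finsetSum _ fun x' _ =>
      Real.continuous_cos.comp (EtaBoundsTransfer.continuous_phase _)
  -- the block weight is `≥ (2N+1)⁶/64` on the small cube
  have hWlow : ∀ k ∈ Set.pi Set.univ (fun _ : Fin 3 => Set.Icc (-ρ) ρ),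
      (2 * N + 1 : ℝ) ^ 6 / 64 ≤ ∑ x ∈ box 3 N, ∑ x' ∈ box 3 N, Real.cos (phase 3 k (x' - x)) := by
    intro k hk
    refine spectralBallMass_weight_lower N fun j => ?_
    have hj := Set.mem_univ_pi.mp hk j
    have habs : |k j| ≤ ρ := abs_le.mpr ⟨hj.1, hj.2⟩
    exact (mul_le_mul_of_nonneg_left habs (Nat.cast_nonneg N)).trans hNρ
  -- Parseval + the count bound + the susceptibility bound
  have hB : ∫ k in Set.pi Set.univ (fun _ : Fin 3 => Set.Icc (-Real.pi) Real.pi),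
      (∑ x ∈ box 3 N, ∑ x' ∈ box 3 N, Real.cos (phase 3 k (x' - x))) *
        (∑ z ∈ box 3 L, ∑ z' ∈ box 3 L, G (z' - z) * Real.cos (phase 3 k (z' - z)))
      ≤ (2 * Real.pi) ^ 3 * ((2 * L + 1) ^ 3 * (C_G * (2 * N + 1) ^ 5)) := by
    rw [hPars N]
    refine mul_le_mul_of_nonneg_left ?_ (by positivity)
    calc ∑ x ∈ box 3 N, ∑ x' ∈ box 3 N, G (x' - x) *
          ((((box 3 L) ×ˢ (box 3 L)).filter (fun p : Site 3 × Site 3 => p.2 - p.1 = x' - x)).card : ℝ)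
        ≤ ∑ x ∈ box 3 N, ∑ x' ∈ box 3 N, G (x' - x) * (2 * L + 1) ^ 3 :=
          Finset.sum_le_sum fun x _ => Finset.sum_le_sum fun x' _ =>
            mul_le_mul_of_nonneg_left (by exact_mod_cast hcount (x' - x)) (hG _)
      _ = (2 * L + 1) ^ 3 * ∑ x ∈ box 3 N, ∑ x' ∈ box 3 N, G (x' - x) := by
          rw [Finset.mul_sum]
          refine Finset.sum_congr rfl fun x _ => ?_
          rw [Finset.mul_sum]
          exact Finset.sum_congr rfl fun x' _ => mul_comm _ _
      _ ≤ (2 * L + 1) ^ 3 * (C_G * (2 * N + 1) ^ 5) :=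
          mul_le_mul_of_nonneg_left (hSus N) (by positivity)
  have hA : (0 : ℝ) < (2 * N + 1 : ℝ) ^ 6 / 64 := by positivity
  have key := spectralBallMass_of_weight
    (g := fun k : Fin 3 → ℝ => ∑ z ∈ box 3 L, ∑ z' ∈ box 3 L, G (z' - z) * Real.cos (phase 3 k (z' - z)))
    (W := fun k : Fin 3 → ℝ => ∑ x ∈ box 3 N, ∑ x' ∈ box 3 N, Real.cos (phase 3 k (x' - x)))
    hρ1 hg_cont hW_cont hpos (spectralBallMass_weight_nonneg N) hA hWlow hB
  refine key.trans ?_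
  rw [div_le_iff₀ hA]
  have hP : (0 : ℝ) ≤ (2 * Real.pi) ^ 3 * C_G * (2 * L + 1) ^ 3 * (2 * N + 1) ^ 5 := by positivity
  nlinarith [mul_le_mul_of_nonneg_left hρN hP]

end Summit.CriticalPhenomena.Ising3DConformalLimit.Cruxes.DirectCorrelationStableTail.DiffusiveBranchIsNonsaturation

end
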